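import Mathlib
import HarnessLib
import Summits.HubbardSuperconductivity.HubbardSuperconductivity.Theorems.KLProgrammeH10TwoPointLimitKlAnisoOneAnchoredSectorCount
import Summits.HubbardSuperconductivity.HubbardSuperconductivity.Theorems.KLProgrammeKLRegimeEngineTowerImportXFloorPlain

/-!
# K3 ENGINE child `KLRegimeEngineV17F2` (stmt-HubbardSuperconductivity-20437), stub (b) import `ι₁` (two legs, floor units): the ONE-ANCHOR two-leg sector count,
# NAMED DOORS `klThinCount2C`, `klThinCount2C₃ R`, `klThinCount2U₀ R`, and the TWO-LEG FLOOR IMPORT modulo the all-fixed line `B₂` / the plain line `S₂`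

Cell gate-hubbard-kl, seat hubbard-kl-k3c2-p3 (g15), row «sector-counting import», located «(ℓ)-IMPORT-ι₁-FLOOR» (KL STATUS 2026-08-29).  WHY.  The floor-keyed law
(`klTowerBLevF_le_law_lev_of_blocks[_Z|_ZX|_ZX_klEng]`) imports, per block `k`, the two-leg floor array `W·Z·klTowerMuLevF … d k 1 ≤ ι₁·λ`; in the kit's vocabulary
`klTowerMuLevF … d k 1 = max_t 27^{t+1}·klTowerMeasLev … d k 2 (t+1)/klLevUnitF β M t 1 (dk−1)`, the levels `t+1 ≥ 3` are empty at two legs, and at the tracks `t = 0, 1`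
the unit is `klLevUnitF β M t 1 J = ε/4^J` (no level gain).  BGM (2.76)–(2.77): `‖W₂‖ ≤ (one-anchor count) × (all-fixed pinned line)`, and the one-anchor count of
two-leg label tuples is an ABSOLUTE constant (…KlAnisoOneAnchoredSectorCount) — so the import reads `≤ 729·C·4^{J}·B₂/ε`: k-uniform exactly when the two-leg line
carries the renormalised gain `B₂ ≲ 4^{−J}` (E1's / the (c)-lane's two-leg currency; a hypothesis here).

* §1 `card_filter_eq_le_of_oneAnchored` (a one-anchor count IS a one-anchored count, any alphabet);
* §2 the named witnesses `klThinCount2C`, `klThinCount2C₃ R`, `klThinCount2U₀ R` (closed terms, pattern of …EngineThinCount6Doors) and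
  **`card_bgmSectorSet_klAniso_two_anchored_le_doors`** — `#{Ω ∈ bgmSectorSet … 2 : Ω p = s} ≤ klThinCount2C`;
* §3 `klLevUnitF_one_eq`, `klLevUnitF_one_eq_of_gain_zero`, **`klLevNormOf_two_le_card_mul`**, **`klTowerMeasLev_two_le_count_mul`**, the import
  **`klTowerMuLevF_one_le_floor_import_doors`**: `klTowerMuLevF L M β U μ K d k 1 ≤ 729·klThinCount2C·4^{dk−1}·B₂/ε` under the doors and an all-fixed anisotropic
  two-leg pinned line `B₂` of the block input, and **`klTowerMuLevF_one_le_floor_import_of_plainLine_klEng`**: the same on a PLAIN two-leg line `S₂` of `𝒱_{dk}[K]`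
  (`B₂ := CA²·S₂`, `fixedTupleL1_klAniso_le_of_plain_klEng_legs` at `m = 1` and `pinnedSum_le_of_fixedTupleL1_le_legs`, p690921) under the stub binders.
Definitions with bodies + order lemmas + consumer theorems; nothing about the model is asserted beyond the landed counts; nothing asserts (ℓ), any stub, K3 or
superconductivity.  References: BGM 2006 §2.7 (2.71a), §2.8 (2.73), (2.76)–(2.80), (2.96)–(2.98), Lemma 2.5 [cite: BenfattoGiulianiMastropietro2006].
-/

noncomputable section

namespace Summit.HubbardSuperconductivity.HubbardSuperconductivity.Theorems.KLRegimeSplit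

set_option linter.dupNamespace false -- summit = problem name (single-conjunct summit), D-0017

open Real Finset Literature.MathematicalPhysics.QuantumLattice Literature.Probability.LatticeModels
open Summit.HubbardSuperconductivity.HubbardSuperconductivity.Theorems.KLProgrammeLegKernels
open Summit.HubbardSuperconductivity.HubbardSuperconductivity.Theorems.DispersionFlow
open Summit.HubbardSuperconductivity.HubbardSuperconductivity.Theorems.PerturbedFermiCurve

/-! ## §1 A one-anchor count is a one-anchored count -/

/-- **One anchor**: if every count of a set `A` of two-leg label tuples over an alphabet `S` with at least one leg prescribed is `≤ C`, then every one-anchored count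
`#{Ω ∈ A : Ω p = s}` is `≤ C` (`E = {p}`). [folklore] -/
theorem card_filter_eq_le_of_oneAnchored {S : Type*} [DecidableEq S] (A : Finset (Fin 2 → S)) {C : ℝ}
    (h1 : ∀ (E : Finset (Fin 2)), 1 ≤ E.card → ∀ τ : Fin 2 → S, (((A.filter (fun Ω : Fin 2 → S => ∀ e ∈ E, Ω e = τ e)).card : ℕ) : ℝ) ≤ C)
    (p : Fin 2) (s : S) :
    (((A.filter (fun Ω : Fin 2 → S => Ω p = s)).card : ℕ) : ℝ) ≤ C := by
  have hE : A.filter (fun Ω : Fin 2 → S => Ω p = s) = A.filter (fun Ω : Fin 2 → S => ∀ e ∈ ({p} : Finset (Fin 2)), Ω e = (fun _ : Fin 2 => s) e) :=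
    Finset.filter_congr fun Ω _ => by simp
  rw [hE]
  exact h1 {p} (by simp) (fun _ => s)

/-! ## §2 The named witnesses and the one-anchor two-leg count under the doors -/

open Classical in
/-- **`klThinCount2C`** — the geometric constant of the one-anchored two-leg anisotropic sector count on `klWindowC` (the classical witness `C` of
`card_bgmSectorSet_klAniso_oneAnchored_le_window`; independent of `R`, `β`, `U`, `c`, `L`, `M`, the scale, the anchored leg and its label). -/
def klThinCount2C : ℝ := Classical.choose card_bgmSectorSet_klAniso_oneAnchored_le_window

/-- `0 < klThinCount2C`. -/
theorem klThinCount2C_pos : 0 < klThinCount2C := (Classical.choose_spec card_bgmSectorSet_klAniso_oneAnchored_le_window).1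

/-- The defining property of `klThinCount2C`. -/
theorem klThinCount2C_spec : ∀ R : RenConsts, (∀ j, 0 ≤ R.Gfr j) →
    ∃ c₃ : ℝ, 0 < c₃ ∧ ∃ U₀ : ℝ, 0 < U₀ ∧
      ∀ c : ℝ, 0 < c → c ≤ c₃ → ∀ U : ℝ, 0 < U → U ≤ U₀ → ∀ β : ℝ, klBetaMin ≤ β → β ≤ Real.exp (c / U ^ 2) →
      ∀ μ ∈ klWindowC, ∀ (ν : ℝ) (K : TrigPolyC4v), FrameOK R U (nScales β) ν K →
      ∀ (L M : ℕ) [NeZero L] (n : ℕ) (E : Finset (Fin 2)), 1 ≤ E.card → ∀ τ : Fin 2 → SectorLeg (sectorCount n),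
      ((((bgmSectorSet L M (klAnisoFamily L M β μ K klE0 n) 2).filter
          (fun Ω : Fin 2 → SectorLeg (sectorCount n) => ∀ e ∈ E, Ω e = τ e)).card : ℕ) : ℝ) ≤ klThinCount2C :=
  (Classical.choose_spec card_bgmSectorSet_klAniso_oneAnchored_le_window).2

open Classical in
/-- **`klThinCount2C₃ R`** — the coupling-temperature door of the two-leg count (classical witness; `1` off the admissible set). -/
def klThinCount2C₃ (R : RenConsts) : ℝ :=
  if h : (∀ j, 0 ≤ R.Gfr j) then Classical.choose (klThinCount2C_spec R h) else 1

open Classical in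
/-- **`klThinCount2U₀ R`** — the coupling door of the two-leg count (classical witness; `1` off the admissible set). -/
def klThinCount2U₀ (R : RenConsts) : ℝ :=
  if h : (∀ j, 0 ≤ R.Gfr j) then Classical.choose (Classical.choose_spec (klThinCount2C_spec R h)).2 else 1

/-- `0 < klThinCount2C₃ R`. -/
theorem klThinCount2C₃_pos (R : RenConsts) : 0 < klThinCount2C₃ R := by
  classical
  unfold klThinCount2C₃
  split_ifs with h
  · exact (Classical.choose_spec (klThinCount2C_spec R h)).1
  · exact one_pos

/-- `0 < klThinCount2U₀ R`. -/
theorem klThinCount2U₀_pos (R : RenConsts) : 0 < klThinCount2U₀ R := by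
  classical
  unfold klThinCount2U₀
  split_ifs with h
  · exact (Classical.choose_spec (Classical.choose_spec (klThinCount2C_spec R h)).2).1
  · exact one_pos

/-- **THE ONE-ANCHOR TWO-LEG ANISOTROPIC SECTOR COUNT UNDER THE NAMED DOORS**: for `R` with `0 ≤ R.Gfr j`, `0 < c ≤ klThinCount2C₃ R`, `0 < U ≤ klThinCount2U₀ R`,
`klBetaMin ≤ β ≤ e^{c/U²}`, `μ ∈ klWindowC`, every frame with `FrameOK R U (nScales β) ν K`, every `L ≥ 1`, `M`, scale `n`, anchor leg `p` and label `s`: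
`#{Ω ∈ bgmSectorSet L M (klAnisoFamily L M β μ K klE0 n) 2 : Ω p = s} ≤ klThinCount2C` — an ABSOLUTE constant.
[cite: BenfattoGiulianiMastropietro2006, §2.8 (2.73), (2.76)–(2.80), (2.96)–(2.98), Lemma 2.5, App. A3] -/
theorem card_bgmSectorSet_klAniso_two_anchored_le_doors {R : RenConsts} (hR : ∀ j, 0 ≤ R.Gfr j) {c : ℝ} (hc : 0 < c)
    (hc₃ : c ≤ klThinCount2C₃ R) {U : ℝ} (hU : 0 < U) (hU₀ : U ≤ klThinCount2U₀ R) {β : ℝ} (hβ : klBetaMin ≤ β)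
    (hβc : β ≤ Real.exp (c / U ^ 2)) {μ : ℝ} (hμ : μ ∈ klWindowC) (ν : ℝ) {K : TrigPolyC4v} (hK : FrameOK R U (nScales β) ν K)
    (L M : ℕ) [NeZero L] (n : ℕ) (p : Fin 2) (s : SectorLeg (sectorCount n)) :
    ((((bgmSectorSet L M (klAnisoFamily L M β μ K klE0 n) 2).filter
        (fun Ω : Fin 2 → SectorLeg (sectorCount n) => Ω p = s)).card : ℕ) : ℝ) ≤ klThinCount2C := by
  classical
  have h3 : klThinCount2C₃ R = Classical.choose (klThinCount2C_spec R hR) := by unfold klThinCount2C₃; exact dif_pos hR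
  have hU' : klThinCount2U₀ R = Classical.choose (Classical.choose_spec (klThinCount2C_spec R hR)).2 := by
    unfold klThinCount2U₀; exact dif_pos hR
  have hspec := (Classical.choose_spec (Classical.choose_spec (klThinCount2C_spec R hR)).2).2
  rw [h3] at hc₃
  rw [hU'] at hU₀
  exact card_filter_eq_le_of_oneAnchored _ (fun E hE τ => hspec c hc hc₃ U hU hU₀ β hβ hβc μ hμ ν K hK L M n E hE τ) p s

end Summit.HubbardSuperconductivity.HubbardSuperconductivity.Theorems.KLRegimeSplit

/-! ## §3 The two-leg floor import -/

namespace Summit.HubbardSuperconductivity.HubbardSuperconductivity.Theorems.EngineV8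

set_option linter.dupNamespace false -- summit = problem name (single-conjunct summit), D-0017

open Classical
open Real Finset Literature.MathematicalPhysics.QuantumLattice Literature.Probability.LatticeModels GrassmannAlgebra
open Literature.MathematicalPhysics.QuantumLattice.FermiRG
open Summit.HubbardSuperconductivity.HubbardSuperconductivity.Theorems.KLRegimeSplit
open Summit.HubbardSuperconductivity.HubbardSuperconductivity.Theorems.KLProgrammeLegKernels
open Summit.HubbardSuperconductivity.HubbardSuperconductivity.Theorems.DispersionFlow
open Summit.HubbardSuperconductivity.HubbardSuperconductivity.Theorems.KLRegimeWick

variable {L M : ℕ} [NeZero L]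

omit [NeZero L] in
/-- **The two-leg floor unit**: `klLevUnitF β M t 1 J = ε/(4^J·2^{klLevGain t·J})` on every track `t`. -/
theorem klLevUnitF_one_eq (β : ℝ) (M : ℕ) (t : Fin 5) (J : ℕ) :
    klLevUnitF β M t 1 J = imagTimeWeight β M / ((4 : ℝ) ^ J * (2 : ℝ) ^ (klLevGain t * J)) := by
  unfold klLevUnitF
  have h32 : (8 : ℝ) ^ J * (4 : ℝ) ^ J = (2 : ℝ) ^ (5 * J) := by
    rw [← mul_pow, pow_mul]; norm_num
  have h5 : (2 : ℝ) ^ (5 * J) * (2 : ℝ) ^ (klLevGain t * J) ≠ 0 := by positivity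
  have h4 : (4 : ℝ) ^ J * (2 : ℝ) ^ (klLevGain t * J) ≠ 0 := by positivity
  rw [show 2 * 1 - 1 = 1 from rfl, pow_one, Nat.mul_one, div_eq_div_iff h5 h4]
  calc imagTimeWeight β M * (8 : ℝ) ^ J * ((4 : ℝ) ^ J * (2 : ℝ) ^ (klLevGain t * J))
      = imagTimeWeight β M * ((8 : ℝ) ^ J * (4 : ℝ) ^ J) * (2 : ℝ) ^ (klLevGain t * J) := by ring
    _ = imagTimeWeight β M * ((2 : ℝ) ^ (5 * J) * (2 : ℝ) ^ (klLevGain t * J)) := by rw [h32]; ring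

omit [NeZero L] in
/-- **The two-leg floor unit on a track without level gain**: `klLevUnitF β M t 1 J = ε/4^J` whenever `klLevGain t = 0` (tracks `0` and `1`). -/
theorem klLevUnitF_one_eq_of_gain_zero (β : ℝ) (M : ℕ) {t : Fin 5} (ht : klLevGain t = 0) (J : ℕ) :
    klLevUnitF β M t 1 J = imagTimeWeight β M / (4 : ℝ) ^ J := by
  rw [klLevUnitF_one_eq, ht, zero_mul, pow_zero, mul_one]

/-- **ONE-PRESCRIBED TWO-LEG SIZE ≤ ONE-ANCHOR COUNT × ALL-FIXED SIZE** (any `T`, family `J`, prescription `Ωe`): if every one-anchored count of compatible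
anisotropic pairs is `≤ N_c` and every compatible pair's pinned `L¹` size `ε·Σ_{X : X p = x} ‖W^{F_J}_{2,Ω}(T)(X)‖` is `≤ B₂`, then `klLevNormOf L M β μ K J 2 T Ωe ≤ N_c · B₂`.
[cite: BenfattoGiulianiMastropietro2006, §2.8 (2.76)-(2.77) and (2.96)] -/
theorem klLevNormOf_two_le_card_mul {β : ℝ} (hβ : 0 ≤ β) (μ : ℝ) (K : TrigPolyC4v) (J : ℕ) (T : HubbardGrassmann L M)
    (Ωe : Fin 2 → Option (SectorLeg (sectorCount J))) {Nc B₂ : ℝ} (hNc : 0 ≤ Nc) (hB : 0 ≤ B₂)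
    (hcount : ∀ (p : Fin 2) (s : SectorLeg (sectorCount J)),
      ((((bgmSectorSet L M (klAnisoFamily L M β μ K klE0 J) 2).filter
        (fun Ω : Fin 2 → SectorLeg (sectorCount J) => Ω p = s)).card : ℕ) : ℝ) ≤ Nc)
    (hline : ∀ Ω ∈ bgmSectorSet L M (klAnisoFamily L M β μ K klE0 J) 2, ∀ (p : Fin 2) (x : SpaceTimeIdx L M),
      imagTimeWeight β M ^ 1 * ∑ X ∈ univ.filter (fun X : Fin 2 → SpaceTimeIdx L M => X p = x),
        ‖sectorisedKernel L M β (klAnisoFamily L M β μ K klE0 J) T 2 Ω X‖ ≤ B₂) :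
    klLevNormOf L M β μ K J 2 T Ωe ≤ Nc * B₂ := by
  unfold klLevNormOf
  rw [hubbardSectorKernelNorm_def]
  refine (sectorisedKernelNorm_mono_set (imagTimeWeight_nonneg hβ M) (prescribedTuples_subset _ _) _).trans ?_
  exact sectorisedKernelNorm_le_card_mul (imagTimeWeight β M) (m := 1) _ _ hNc hB hcount hline

/-- **THE MEASURED LEVELLED TWO-LEG SIZE OF BLOCK `k` FROM A ONE-ANCHOR COUNT** (input `𝒱_{dk}` at `F_{dk−1}`, every level `F`): `klTowerMeasLev … d k 2 F ≤ N_c·B₂`.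
[cite: BenfattoGiulianiMastropietro2006, §2.8 (2.76)-(2.77), (2.96)] -/
theorem klTowerMeasLev_two_le_count_mul [NeZero M] {β : ℝ} (hβ : 0 ≤ β) (U μ : ℝ) (K : TrigPolyC4v) (d k F : ℕ) {Nc B₂ : ℝ} (hNc : 0 ≤ Nc) (hB : 0 ≤ B₂)
    (hcount : ∀ (p : Fin 2) (s : SectorLeg (sectorCount (d * k - 1))),
      ((((bgmSectorSet L M (klAnisoFamily L M β μ K klE0 (d * k - 1)) 2).filter
        (fun Ω : Fin 2 → SectorLeg (sectorCount (d * k - 1)) => Ω p = s)).card : ℕ) : ℝ) ≤ Nc)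
    (hline : ∀ Ω ∈ bgmSectorSet L M (klAnisoFamily L M β μ K klE0 (d * k - 1)) 2, ∀ (p : Fin 2) (x : SpaceTimeIdx L M),
      imagTimeWeight β M ^ 1 * ∑ X ∈ univ.filter (fun X : Fin 2 → SpaceTimeIdx L M => X p = x),
        ‖sectorisedKernel L M β (klAnisoFamily L M β μ K klE0 (d * k - 1)) (klTowerInput L M β U μ K d k) 2 Ω X‖ ≤ B₂) :
    klTowerMeasLev L M β U μ K d k 2 F ≤ Nc * B₂ := by
  unfold klTowerMeasLev
  refine Real.iSup_le (fun Ωe => ?_) (mul_nonneg hNc hB)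
  exact klLevNormOf_two_le_card_mul hβ μ K (d * k - 1) _ Ωe.1 hNc hB hcount hline

/-- **THE TWO-LEG FLOOR IMPORT UNDER THE NAMED DOORS** («(ℓ)-IMPORT-ι₁-FLOOR» cured modulo the all-fixed two-leg line `B₂`): for `R` with `0 ≤ R.Gfr j`,
`0 < c ≤ klThinCount2C₃ R`, `0 < U ≤ klThinCount2U₀ R`, `klBetaMin ≤ β ≤ e^{c/U²}`, `μ ∈ klWindowC`, a frame with `FrameOK R U (nScales β) ν K`, and an all-fixed
anisotropic two-leg pinned line `B₂ ≥ 0` of the block input `𝒱_{dk}` sectorised with `F_{dk−1}`: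
**`klTowerMuLevF L M β U μ K d k 1 ≤ 729·klThinCount2C·4^{dk−1}·B₂/ε`** — tracks `0, 1` carry the unit `ε/4^{dk−1}`, the levels `≥ 3` are empty at two legs; the
`4^{dk−1}` is the floor unit's and is paid by the renormalised two-leg line (E1's hypothesis).
[cite: BenfattoGiulianiMastropietro2006, §2.7 (2.71a), §2.8 (2.96)-(2.98), Lemma 2.5] -/
theorem klTowerMuLevF_one_le_floor_import_doors [NeZero M] {R : RenConsts} (hR : ∀ j, 0 ≤ R.Gfr j) {c : ℝ} (hc : 0 < c)
    (hc₃ : c ≤ klThinCount2C₃ R) {U : ℝ} (hU : 0 < U) (hU₀ : U ≤ klThinCount2U₀ R) {β : ℝ} (hβ : klBetaMin ≤ β) (hβc : β ≤ Real.exp (c / U ^ 2))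
    {μ : ℝ} (hμ : μ ∈ klWindowC) (ν : ℝ) {K : TrigPolyC4v} (hK : FrameOK R U (nScales β) ν K) (d k : ℕ) {B₂ : ℝ} (hB : 0 ≤ B₂)
    (hline : ∀ Ω ∈ bgmSectorSet L M (klAnisoFamily L M β μ K klE0 (d * k - 1)) 2, ∀ (p : Fin 2) (x : SpaceTimeIdx L M),
      imagTimeWeight β M ^ 1 * ∑ X ∈ univ.filter (fun X : Fin 2 → SpaceTimeIdx L M => X p = x),
        ‖sectorisedKernel L M β (klAnisoFamily L M β μ K klE0 (d * k - 1)) (klTowerInput L M β U μ K d k) 2 Ω X‖ ≤ B₂) :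
    klTowerMuLevF L M β U μ K d k 1 ≤ 729 * klThinCount2C * (4 : ℝ) ^ (d * k - 1) * B₂ / imagTimeWeight β M := by
  have hβ0 : 0 < β := KLRegimeSplit.pos_of_klBetaMin_le hβ
  have hε : 0 < imagTimeWeight β M := imagTimeWeight_pos_of_pos (M := M) hβ0
  have hC : 0 ≤ klThinCount2C := klThinCount2C_pos.le
  set J := d * k - 1 with hJ
  have h4J : (0 : ℝ) < (4 : ℝ) ^ J := by positivity
  -- the level-blind bound from the one-anchor count
  have h1 : ∀ F, klTowerMeasLev L M β U μ K d k 2 F ≤ klThinCount2C * B₂ := fun F =>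
    klTowerMeasLev_two_le_count_mul hβ0.le U μ K d k F hC hB
      (fun p s => card_bgmSectorSet_klAniso_two_anchored_le_doors hR hc hc₃ hU hU₀ hβ hβc hμ ν hK L M J p s) hline
  have hCB : 0 ≤ klThinCount2C * B₂ := mul_nonneg hC hB
  -- the bound per track
  have hεne : imagTimeWeight β M ≠ 0 := hε.ne'
  have h4ne : (4 : ℝ) ^ J ≠ 0 := h4J.ne'
  have htrack : ∀ t : Fin 5, klTowerMuLevAtF L M β U μ K d t k 1 ≤ 729 * klThinCount2C * (4 : ℝ) ^ J * B₂ / imagTimeWeight β M := by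
    intro t
    have hU0 : 0 < klLevUnitF β M t 1 J := klLevUnitF_pos hβ0 t 1 J
    unfold klTowerMuLevAtF
    rw [show 2 * 1 = 2 from rfl, ← hJ, div_le_iff₀ hU0]
    by_cases ht2 : (t : ℕ) + 1 ≤ 2
    · -- tracks 0, 1: unit `ε/4^J`, the level-blind count
      have hg : klLevGain t = 0 := by
        unfold klLevGain levelGainExp; omega
      rw [klLevUnitF_one_eq_of_gain_zero β M hg J]
      have h27 : (27 : ℝ) ^ ((t : ℕ) + 1) ≤ 729 :=
        calc (27 : ℝ) ^ ((t : ℕ) + 1) ≤ (27 : ℝ) ^ 2 := pow_le_pow_right₀ (by norm_num) ht2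
          _ = 729 := by norm_num
      have hM0 : 0 ≤ klTowerMeasLev L M β U μ K d k 2 ((t : ℕ) + 1) := klTowerMeasLev_nonneg hβ0.le U μ K d k _ _
      calc (27 : ℝ) ^ ((t : ℕ) + 1) * klTowerMeasLev L M β U μ K d k 2 ((t : ℕ) + 1) ≤ 729 * (klThinCount2C * B₂) :=
            mul_le_mul h27 (h1 _) hM0 (by norm_num)
        _ = 729 * klThinCount2C * (4 : ℝ) ^ J * B₂ / imagTimeWeight β M * (imagTimeWeight β M / (4 : ℝ) ^ J) := by
            field_simp
    · -- tracks 2, 3, 4: level `t + 1 ≥ 3 > 2` legs, empty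
      rw [klTowerMeasLev_eq_zero_of_lt β U μ K d k (by omega : 2 < (t : ℕ) + 1), mul_zero]
      positivity
  -- the track-blind array is the maximum over the tracks
  obtain ⟨t, ht⟩ := exists_klTowerMuLevF_eq (L := L) (M := M) β U μ K d k 1
  rw [ht]
  exact htrack t

/-- **THE TWO-LEG FLOOR IMPORT FROM THE PLAIN TWO-LEG LINE, UNDER THE STUB BINDERS**: `∃ CA > 0` absolute such that, under the stub binders (`P.WF`, `R.WF2`,
`c ≤ klEngC₃6`, `U ≤ klEngU₀9`, `klEngL₃`, `klEngM₃`, `FrameOK`) and the two-count doors (`c ≤ klThinCount2C₃ R`, `U ≤ klThinCount2U₀ R`), for every block length `d`,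
block `k` with `1 ≤ dk − 1 ≤ nScales β + 1`, and `S₂ ≥ 0`: if for all spin/charge strings and every pin the plain two-leg kernel of `𝒱_{dk}[K]` has
`fixedTupleL1 β 1 … ≤ S₂`, then `klTowerMuLevF L M β U μ K d k 1 ≤ 729·klThinCount2C·4^{dk−1}·(CA²·S₂)/ε` — the `ι₁` row of the F-law on the producer target `S₂`.
[cite: BenfattoGiulianiMastropietro2006, §2.7 (2.71a), §2.8 (2.76)-(2.77), (2.96)-(2.98), Lemma 2.5] -/
theorem klTowerMuLevF_one_le_floor_import_of_plainLine_klEng :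
    ∃ CA : ℝ, 0 < CA ∧ ∀ (P : SplitConsts) (R : RenConsts) (c : ℝ), P.WF → R.WF2 → 0 < c → c ≤ klEngC₃6 P R → c ≤ klThinCount2C₃ R →
      ∀ μ ∈ klWindowC, ∀ U : ℝ, 0 < U → U ≤ klEngU₀9 P R c → U ≤ klThinCount2U₀ R → ∀ β : ℝ, klBetaMin ≤ β → β ≤ Real.exp (c / U ^ 2) →
      ∀ K : TrigPolyC4v, FrameOK R U (nScales β) μ K → ∀ (L M : ℕ) [NeZero L] [NeZero M],
      klEngL₃ β U ≤ L → klEngM₃ β U L ≤ M → ∀ d k : ℕ, 1 ≤ d * k - 1 → d * k - 1 ≤ nScales β + 1 →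
        ∀ S₂ : ℝ, 0 ≤ S₂ →
          (∀ (s c' : Fin 2 → Fin 2) (y₀ : SpaceTimeIdx L M),
            fixedTupleL1 L M β 1 (sectorisedKernel L M β (trivialMultiplier L M) (klTowerInput L M β U μ K d k) 2)
              (fun i => (((0 : Fin 1), s i), c' i)) y₀ ≤ S₂) →
          klTowerMuLevF L M β U μ K d k 1 ≤ 729 * klThinCount2C * (4 : ℝ) ^ (d * k - 1) * (CA ^ 2 * S₂) / imagTimeWeight β M := by
  obtain ⟨CA, hCA, h⟩ := fixedTupleL1_klAniso_le_of_plain_klEng_legs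
  refine ⟨CA, hCA, ?_⟩
  intro P R c hP hR2 hc hc6 hcT2 μ hμ U hU hU9 hUT2 β hβmin hβc K hK L M _ _ hL3 hM3 d k hn hnN S₂ hS0 hS
  have hRj : ∀ j, 0 ≤ R.Gfr j := gfr_nonneg_of_wf2 hR2
  have hβ0 : β ≠ 0 := (lt_of_lt_of_le (by norm_num [klBetaMin]) hβmin).ne'
  have hB : 0 ≤ CA ^ 2 * S₂ := mul_nonneg (pow_nonneg hCA.le 2) hS0
  refine klTowerMuLevF_one_le_floor_import_doors hRj hc hcT2 hU hUT2 hβmin hβc hμ μ hK d k hB ?_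
  intro Ω _ p x
  -- the aniso all-fixed two-leg line at leg 0 from the plain line (`m = 1`), then any leg by translation invariance
  have hline0 : ∀ x₁ : SpaceTimeIdx L M,
      fixedTupleL1 L M β 1 (sectorisedKernel L M β (klAnisoFamily L M β μ K klE0 (d * k - 1)) (klTowerInput L M β U μ K d k) 2) Ω x₁ ≤
        CA ^ 2 * S₂ := by
    intro x₁
    have hΩ : Ω = fun i => (((Ω i).1.1, (Ω i).1.2), (Ω i).2) := funext fun i => by simp
    rw [hΩ]
    exact h P R c hP hR2 hc hc6 μ hμ U hU hU9 β hβmin hβc K hK L M hL3 hM3 (d * k - 1) hn hnN 1 (klTowerInput L M β U μ K d k)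
      (fun i => (Ω i).1.1) (fun i => (Ω i).1.2) (fun i => (Ω i).2) S₂ hS0 (hS _ _) x₁
  unfold klTowerInput at hline0 ⊢
  exact pinnedSum_le_of_fixedTupleL1_le_legs hβ0 _ U μ K klE0 (d * k) Ω hline0 p x

end Summit.HubbardSuperconductivity.HubbardSuperconductivity.Theorems.EngineV8

end
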